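import Summits.QuantumFields.BalabanUV.T4Continuum.Support.ShellMeasureMultiGridNorms

/-!
# `T4Continuum.ShellMeasureMultiGridNormsMax` — the SOURCE SPACE of [Balaban1985Variational] (98),
# `max{|A′|_{(−1)}, |∇A′|_{(−2)}}`, AS A NORMED SPACE for a GIVEN covariant-derivative datum `∇`, the algebra of
# `Prop4Hyp` (sum ∕ monotonicity), and (P4)'s (98) SHAPE for the `∇`-free plaquette part ON THAT SPACE
# (cell `pub-balaban`, sub-cell `t4`, spine estimate NE7c (node U5b), crew lineage `b2b-balaban-t4-ne7c-formalise-leaf-02`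
# gen 8, owner table `LEAVES-NE7c-P1.md` row S65 file f2c; imports this lineage's f2a `ShellMeasureMultiGridNorms`
# ONLY; [folklore]; 0 sorry)

HONEST FRAMING.  Finite four-torus programme, rung (B)+1 only — NOT infinite volume, NOT a mass gap, NOT the Clay
problem, NOT summit progress; (B), `BetaPertHyp`, (B^μ) are not consumed.  NE7c (`T4IndicatorShell.ShellWeightBound`)
is NOT PRINTED and NOT PROVED; «NE7c ⇐ the named binders» (WALL `t4/b2b-balaban-t4-ne7c-p1/WALL-NE7c-P1.md` §2).
WEIGHTED-ℓ^∞ BOOKKEEPING ([folklore]); nothing printed is asserted or cited as a fact; no `def … : Prop` is minted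
(the `def`s are DATA: a type synonym, its embedding, two identity maps).  HONEST DEPENDENCY (cell): continuum YM on T⁴
⇐ BetaPertH ∧ nine spine estimates (0/9 proved); BetaPertH ⇐ (D1) ∧ (D4) ∧ CAP+tail; G-an2-4 gates asym, D1 and
NE2/3/4.

THE POINT (locator `HOME/b2b-balaban-t4-ne7c-formalise-leaf-02/XREAD-P4-B11-SectB.md` §3 (i)–(j)).  Prop. 4 reads
(p. 293, verbatim, LOCATOR ONLY): *«|((δ∕δA′)V)(A′)|_{(−3)} ≤ C₄(max{|A′|_{(−1)}, |∇A′|_{(−2)}})², (98) and it is valid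
if max{|A′|_{(−1)}, |∇A′|_{(−2)}} ≤ a₃»* — the SOURCE norm is the max of the weighted sup norm of the field and the
weighted sup norm of its covariant derivative `∇ = ∇^η_{U₀}`, a bounded linear map that depends on the background (Sect.
B opening: *«The configuration U₀ and the scale η are fixed, so … we will write R, D instead of R(U₀), D^η_{U₀}»*).  The
lineage's f2a types `|·|_{(−α)}` (`WSup w α`) and states the `∇`-free part of (98) from `WSup w 1`; the locator's census
(§3 (j)) splits `W = W′ + W_∇` with `W′` controlled by `|·|_{(−1)}` alone and `W_∇` by the max norm.  WHAT THIS FILE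
DOES, for ABSTRACT data (`∇` = any continuous linear `Dv : (Λ → 𝔄) →L[ℂ] (Λ′ → 𝔅)` into a second weighted family —
for Bałaban `Λ′` = (site, μ, ν), `w′ = ` the plaquette scale weight, exponent 2):
* §1 `Prop4Hyp.add`, `Prop4Hyp.mono`: the (98) shape is additive in `W` (constants add) and monotone in `(C, a)` — the
  bookkeeping by which `W′` (this lineage, f2a∕f2b) and `W_∇` (S65 f3) assemble into ONE `hW`;
* §2 the type synonym `WMax w w′ Dv := Λ → 𝔄` normed by `‖A‖ = max (‖A‖_{(−1)}) (‖Dv A‖_{(−2)})`, INDUCED along the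
  injective linear map `A ↦ (scale w 1 A, scale w′ 2 (Dv A))` into the sup-normed product (no axiom checked by hand):
  `norm_def`, `norm_wsup_le` (`‖A‖_{(−1)} ≤ ‖A‖_max`), `norm_deriv_le` (`‖Dv A‖_{(−2)} ≤ ‖A‖_max`), the identity
  `toWSupL : WMax … →L[ℂ] WSup w 1 𝔄` with `‖toWSupL A‖ ≤ ‖A‖`, and the identity `toPiL : WMax … ≃L[ℂ] (Λ → 𝔄)`
  (finite volume + `Dv` bounded: same topology, same analytic maps as the flat product);
* §3 **`prop4Hyp_of_wsup`**: ANY `Prop4Hyp W C a` from `WSup w 1 𝔄` is a `Prop4Hyp (W ∘ toWSupL) C a` from `WMax`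
  (f2a's `Prop4Hyp.comp_of_norm_le` fired), hence **`prop4Hyp_locGrad_levels_max`**: the `∇`-free plaquette part
  satisfies `Prop4Hyp (…) (8κ·m·Lc⁴) (ε∕2)` FROM THE (98) SOURCE SPACE — literally the shape END-II displays, for this
  part, whatever `∇`-datum the background fixes.
NOT HERE: the `∇`-part `W_∇` itself (S65 f3, one grid over b08's (1.50)∕(1.52)), the cubic binder's discharge (S65 f4),
the HD-dressing (S66), [dict] (node O).  So this is TYPING + bookkeeping; no estimate of Bałaban's is discharged.
-/

noncomputable section

open Metric Set Function

namespace Summit.QuantumFields.BalabanUV.T4Continuum.ShellMeasureMultiGridNormsMax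

open Literature.MathematicalPhysics.QuantumFieldTheory.Balaban1983to89
open B11Prop6Scheme (Prop4Hyp)
open Summit.QuantumFields.BalabanUV.T4Continuum.ShellMeasureLocalGradientTail (locGrad)
open Summit.QuantumFields.BalabanUV.T4Continuum.ShellMeasureMultiGridNorms

/-! ## §1 The algebra of the (98) shape -/

section Algebra

variable {𝒴 𝒵 : Type*} [NormedAddCommGroup 𝒴] [NormedSpace ℂ 𝒴] [NormedAddCommGroup 𝒵] [NormedSpace ℂ 𝒵]

/-- The (98) shape is ADDITIVE: `Prop4Hyp W₁ C₁ a`, `Prop4Hyp W₂ C₂ a` ⟹ `Prop4Hyp (W₁ + W₂) (C₁ + C₂) a` (the assembly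
`W = W′ + W_∇` of the locator's split). [folklore] -/
theorem Prop4Hyp.add {W₁ W₂ : 𝒴 → 𝒵} {C₁ C₂ a : ℝ} (h₁ : Prop4Hyp W₁ C₁ a) (h₂ : Prop4Hyp W₂ C₂ a) :
    Prop4Hyp (W₁ + W₂) (C₁ + C₂) a where
  quad Y hY := by
    calc ‖(W₁ + W₂) Y‖ = ‖W₁ Y + W₂ Y‖ := rfl
      _ ≤ ‖W₁ Y‖ + ‖W₂ Y‖ := norm_add_le _ _
      _ ≤ C₁ * ‖Y‖ ^ 2 + C₂ * ‖Y‖ ^ 2 := add_le_add (h₁.quad Y hY) (h₂.quad Y hY)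
      _ = (C₁ + C₂) * ‖Y‖ ^ 2 := by ring
  differentiableOn := h₁.differentiableOn.add h₂.differentiableOn

/-- The (98) shape is MONOTONE: a larger constant and a smaller radius keep it. [folklore] -/
theorem Prop4Hyp.mono {W : 𝒴 → 𝒵} {C C' a a' : ℝ} (h : Prop4Hyp W C a) (hC : C ≤ C') (ha : a' ≤ a) :
    Prop4Hyp W C' a' where
  quad Y hY := (h.quad Y (hY.trans_le ha)).trans (mul_le_mul_of_nonneg_right hC (sq_nonneg _))
  differentiableOn := h.differentiableOn.mono fun Y (hY : ‖Y‖ < a') => hY.trans_le ha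

/-- A scalar multiple keeps the (98) shape with the constant scaled by `‖c‖` (the displayed weights `η^d`, `½`, `¼ i`
of (39)∕(91)). [folklore] -/
theorem Prop4Hyp.const_smul {W : 𝒴 → 𝒵} {C a : ℝ} (h : Prop4Hyp W C a) (c : ℂ) :
    Prop4Hyp (c • W) (‖c‖ * C) a where
  quad Y hY := by
    calc ‖(c • W) Y‖ = ‖c‖ * ‖W Y‖ := norm_smul c (W Y)
      _ ≤ ‖c‖ * (C * ‖Y‖ ^ 2) := mul_le_mul_of_nonneg_left (h.quad Y hY) (norm_nonneg c)
      _ = ‖c‖ * C * ‖Y‖ ^ 2 := by ring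
  differentiableOn := h.differentiableOn.const_smul c

end Algebra

/-! ## §2 The source space `max{|·|_{(−1)}, |∇·|_{(−2)}}` for a given `∇`-datum -/

variable {Λ : Type*} [Fintype Λ] {𝔄 : Type*} [NormedAddCommGroup 𝔄] [NormedSpace ℂ 𝔄]
variable {Λ' : Type*} [Fintype Λ'] {𝔅 : Type*} [NormedAddCommGroup 𝔅] [NormedSpace ℂ 𝔅]

/-- Bond fields READ WITH THE NORM `max{|A|_{(−1)}, |∇A|_{(−2)}}` for the covariant-derivative datum
`Dv : (Λ → 𝔄) →L[ℂ] (Λ′ → 𝔅)` (Bałaban: `∇^η_{U₀}`, background-dependent) and the weights `w`, `w′` — a type synonym.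
[folklore] -/
@[nolint unusedArguments]
def WMax (_w : Λ → ℝ) (_w' : Λ' → ℝ) (_Dv : (Λ → 𝔄) →L[ℂ] (Λ' → 𝔅)) : Type _ := Λ → 𝔄

namespace WMax

variable (w : Λ → ℝ) (w' : Λ' → ℝ) (Dv : (Λ → 𝔄) →L[ℂ] (Λ' → 𝔅))

/-- The additive group structure of `WMax w w′ Dv` is that of `Λ → 𝔄`. [folklore] -/
instance instAddCommGroup : AddCommGroup (WMax w w' Dv) := inferInstanceAs (AddCommGroup (Λ → 𝔄))

/-- The `ℂ`-module structure of `WMax w w′ Dv` is that of `Λ → 𝔄`. [folklore] -/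
instance instModuleComplex : Module ℂ (WMax w w' Dv) := inferInstanceAs (Module ℂ (Λ → 𝔄))

/-- The identity `WMax w w′ Dv → (Λ → 𝔄)`, linear. [folklore] -/
def toPi : WMax w w' Dv ≃ₗ[ℂ] (Λ → 𝔄) := LinearEquiv.refl ℂ (Λ → 𝔄)

/-- THE EMBEDDING `A ↦ (scale w 1 A, scale w′ 2 (Dv A))` into the sup-normed product (first component = f2a's scaling
of the field, second = f2a's scaling of its covariant derivative). [folklore] -/
def embed : WMax w w' Dv →ₗ[ℂ] (Λ → 𝔄) × (Λ' → 𝔅) :=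
  LinearMap.prod
    ((WSup.scale w 1 : WSup w 1 𝔄 →ₗ[ℂ] (Λ → 𝔄)).comp (toPi w w' Dv).toLinearMap)
    ((WSup.scale w' 2 : WSup w' 2 𝔅 →ₗ[ℂ] (Λ' → 𝔅)).comp ((Dv : (Λ → 𝔄) →ₗ[ℂ] (Λ' → 𝔅)).comp
      (toPi w w' Dv).toLinearMap))

omit [Fintype Λ] [Fintype Λ'] in
/-- Unfolding of the embedding's components. [folklore] -/
theorem embed_apply (A : WMax w w' Dv) :
    embed w w' Dv A = (WSup.scale w 1 (show WSup w 1 𝔄 from A), WSup.scale w' 2 (show WSup w' 2 𝔅 from Dv A)) :=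
  rfl

variable [hw : Fact (∀ b, 0 < w b)] [hw' : Fact (∀ b, 0 < w' b)]

omit [Fintype Λ] [Fintype Λ'] hw' in
/-- The embedding is injective (its first component is). [folklore] -/
theorem embed_injective : Injective (embed w w' Dv) := fun _ _ h =>
  WSup.scale_injective w 1 (congr_arg Prod.fst h)

/-- THE MAX NORM, INDUCED along `embed` from the sup norm of the product. [folklore] -/
instance instNormedAddCommGroup : NormedAddCommGroup (WMax w w' Dv) :=
  NormedAddCommGroup.induced (WMax w w' Dv) ((Λ → 𝔄) × (Λ' → 𝔅)) (embed w w' Dv) (embed_injective w w' Dv)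

/-- … and the induced `ℂ`-normed-space structure. [folklore] -/
instance instNormedSpace : NormedSpace ℂ (WMax w w' Dv) :=
  NormedSpace.induced ℂ (WMax w w' Dv) ((Λ → 𝔄) × (Λ' → 𝔅)) (embed w w' Dv)

/-- **`‖A‖ = max (|A|_{(−1)}) (|∇A|_{(−2)})`**: the norm is the max of f2a's weighted sup norm of the field and f2a's
weighted sup norm of its `∇`-datum. [folklore] -/
theorem norm_def (A : WMax w w' Dv) :
    ‖A‖ = max ‖(show WSup w 1 𝔄 from A)‖ ‖(show WSup w' 2 𝔅 from Dv A)‖ := by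
  change ‖embed w w' Dv A‖ = _
  rw [embed_apply, Prod.norm_def, WSup.norm_def, WSup.norm_def]

/-- `|A|_{(−1)} ≤ ‖A‖_max`. [folklore] -/
theorem norm_wsup_le (A : WMax w w' Dv) : ‖(show WSup w 1 𝔄 from A)‖ ≤ ‖A‖ := by
  rw [norm_def]
  exact le_max_left _ _

/-- `|∇A|_{(−2)} ≤ ‖A‖_max`. [folklore] -/
theorem norm_deriv_le (A : WMax w w' Dv) : ‖(show WSup w' 2 𝔅 from Dv A)‖ ≤ ‖A‖ := by
  rw [norm_def]
  exact le_max_right _ _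

omit [Fintype Λ] [Fintype Λ'] hw hw' in
/-- The identity `WMax w w′ Dv → WSup w 1 𝔄`, linear. [folklore] -/
def toWSupₗ : WMax w w' Dv →ₗ[ℂ] WSup w 1 𝔄 where
  toFun A := show WSup w 1 𝔄 from A
  map_add' _ _ := rfl
  map_smul' _ _ := rfl

/-- THE IDENTITY `WMax w w′ Dv → WSup w 1 𝔄` as a continuous linear map of norm `≤ 1`. [folklore] -/
def toWSupL : WMax w w' Dv →L[ℂ] WSup w 1 𝔄 :=
  (toWSupₗ w w' Dv).mkContinuous 1 fun A => by
    rw [one_mul]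
    exact norm_wsup_le w w' Dv A

/-- `toWSupL` is the identity on underlying functions. [folklore] -/
theorem toWSupL_apply (A : WMax w w' Dv) (b : Λ) : toWSupL w w' Dv A b = A b := rfl

/-- `‖toWSupL A‖ ≤ ‖A‖`. [folklore] -/
theorem norm_toWSupL_le (A : WMax w w' Dv) : ‖toWSupL w w' Dv A‖ ≤ ‖A‖ := norm_wsup_le w w' Dv A

/-- Flat coordinates are bounded by the max norm (through `|·|_{(−1)}` and f2a's comparison constant). [folklore] -/
theorem norm_toPi_le (A : WMax w w' Dv) : ‖toPi w w' Dv A‖ ≤ (∑ b, (w b ^ 1)⁻¹) * ‖A‖ := by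
  have h := WSup.norm_toPi_le w 1 (show WSup w 1 𝔄 from A)
  have hS : 0 ≤ ∑ b, (w b ^ 1)⁻¹ := Finset.sum_nonneg fun b _ => (inv_pos.2 (pow_pos (hw.out b) 1)).le
  exact h.trans (mul_le_mul_of_nonneg_left (norm_wsup_le w w' Dv A) hS)

/-- The max norm is bounded by the flat norm (finite volume; `Dv` bounded). [folklore] -/
theorem norm_ofPi_le (A : Λ → 𝔄) :
    ‖((toPi w w' Dv).symm A : WMax w w' Dv)‖ ≤ ((∑ b, w b ^ 1) + (∑ b, w' b ^ 2) * ‖Dv‖) * ‖A‖ := by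
  rw [norm_def]
  have h1 : ‖(show WSup w 1 𝔄 from ((toPi w w' Dv).symm A : WMax w w' Dv))‖ ≤ (∑ b, w b ^ 1) * ‖A‖ :=
    WSup.norm_ofPi_le w 1 A
  have h2 : ‖(show WSup w' 2 𝔅 from Dv ((toPi w w' Dv).symm A : WMax w w' Dv))‖ ≤
      (∑ b, w' b ^ 2) * ‖Dv‖ * ‖A‖ := by
    have h := WSup.norm_ofPi_le w' 2 (Dv A)
    have hS : 0 ≤ ∑ b, w' b ^ 2 := Finset.sum_nonneg fun b _ => (pow_pos (hw'.out b) 2).le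
    calc _ ≤ (∑ b, w' b ^ 2) * ‖Dv A‖ := h
      _ ≤ (∑ b, w' b ^ 2) * (‖Dv‖ * ‖A‖) := mul_le_mul_of_nonneg_left (Dv.le_opNorm A) hS
      _ = (∑ b, w' b ^ 2) * ‖Dv‖ * ‖A‖ := by ring
  have hS1 : 0 ≤ (∑ b, w b ^ 1) * ‖A‖ :=
    mul_nonneg (Finset.sum_nonneg fun b _ => (pow_pos (hw.out b) 1).le) (norm_nonneg _)
  have hS2 : 0 ≤ (∑ b, w' b ^ 2) * ‖Dv‖ * ‖A‖ :=
    mul_nonneg (mul_nonneg (Finset.sum_nonneg fun b _ => (pow_pos (hw'.out b) 2).le) (norm_nonneg _))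
      (norm_nonneg _)
  refine max_le ?_ ?_
  · calc _ ≤ (∑ b, w b ^ 1) * ‖A‖ := h1
      _ ≤ (∑ b, w b ^ 1) * ‖A‖ + (∑ b, w' b ^ 2) * ‖Dv‖ * ‖A‖ := le_add_of_nonneg_right hS2
      _ = ((∑ b, w b ^ 1) + (∑ b, w' b ^ 2) * ‖Dv‖) * ‖A‖ := by ring
  · calc _ ≤ (∑ b, w' b ^ 2) * ‖Dv‖ * ‖A‖ := h2
      _ ≤ (∑ b, w b ^ 1) * ‖A‖ + (∑ b, w' b ^ 2) * ‖Dv‖ * ‖A‖ := le_add_of_nonneg_left hS1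
      _ = ((∑ b, w b ^ 1) + (∑ b, w' b ^ 2) * ‖Dv‖) * ‖A‖ := by ring

/-- **THE IDENTITY IS A CONTINUOUS LINEAR EQUIVALENCE** `WMax w w′ Dv ≃L[ℂ] (Λ → 𝔄)`: same topology as the flat product
(finite volume, `Dv` bounded), hence the same differentiable∕analytic maps. [folklore] -/
def toPiL : WMax w w' Dv ≃L[ℂ] (Λ → 𝔄) :=
  ContinuousLinearEquiv.equivOfInverse
    ((toPi w w' Dv).toLinearMap.mkContinuous _ (norm_toPi_le w w' Dv))
    ((toPi w w' Dv).symm.toLinearMap.mkContinuous _ (norm_ofPi_le w w' Dv))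
    (fun _ => rfl) (fun _ => rfl)

omit hw hw' in
/-- `toPiL` is the identity on underlying functions. [folklore] -/
theorem toPiL_apply [Fact (∀ b, 0 < w b)] [Fact (∀ b, 0 < w' b)] (A : WMax w w' Dv) (b : Λ) :
    toPiL w w' Dv A b = A b := rfl

end WMax

/-! ## §3 (98) for the `∇`-free plaquette part FROM THE SOURCE SPACE `max{|·|_{(−1)}, |∇·|_{(−2)}}` -/

section Levels

open WMax

variable (w : Λ → ℝ) (w' : Λ' → ℝ) (Dv : (Λ → 𝔄) →L[ℂ] (Λ' → 𝔅))
  [hw : Fact (∀ b, 0 < w b)] [hw' : Fact (∀ b, 0 < w' b)]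

/-- **FROM `|·|_{(−1)}` TO `max{|·|_{(−1)}, |∇·|_{(−2)}}`.**  Any (98)-shape statement from `WSup w 1 𝔄` holds from
`WMax w w′ Dv` with the same constants (the identity does not increase norms; f2a `Prop4Hyp.comp_of_norm_le`).
[folklore] -/
theorem prop4Hyp_of_wsup {𝒵 : Type*} [NormedAddCommGroup 𝒵] [NormedSpace ℂ 𝒵] {W : WSup w 1 𝔄 → 𝒵} {C a : ℝ}
    (hW : Prop4Hyp W C a) (hC : 0 ≤ C) : Prop4Hyp (W ∘ toWSupL w w' Dv) C a :=
  ShellMeasureMultiGridNorms.Prop4Hyp.comp_of_norm_le hW hC (toWSupL w w' Dv) (norm_toWSupL_le w w' Dv)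

variable [DecidableEq Λ] {P : Type*} (Pl : Finset P) (φ : P → (Λ → 𝔄) → ℂ) (supp : P → Finset Λ) (W : P → ℝ)

/-- **END-II's `hW` SHAPE FOR THE `∇`-FREE PLAQUETTE PART, FROM THE (98) SOURCE SPACE.**  Data as in f2a
`prop4Hyp_locGrad_levels`; for ANY `∇`-datum `Dv` and weights `w′`, the bond-local gradient of `V = Σ_p φ_p`, read from
`(fields, max{|·|_{(−1)}, |∇·|_{(−2)}})` to `(gradient fields, |·|_{(−3)})`, satisfies `Prop4Hyp (…) (8·κ·m·Lc⁴) (ε∕2)`.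
([Balaban1985Variational] (98) TYPE for this part — nothing printed is asserted; the `∇`-part, which DOES see `Dv`, is
S65 f3's and adds to this by `Prop4Hyp.add`.) [folklore] -/
theorem prop4Hyp_locGrad_levels_max {ε κ Lc : ℝ} {m : ℕ} (hε : 0 < ε) (hκ : 0 ≤ κ) (hLc1 : 1 ≤ Lc)
    (hW : ∀ p ∈ Pl, 0 < W p)
    (hWw : ∀ p ∈ Pl, ∀ b ∈ supp p, W p ≤ w b) (hwW : ∀ p ∈ Pl, ∀ b ∈ supp p, w b ≤ Lc * W p)
    (ha : ∀ p ∈ Pl, AnalyticOnNhd ℂ (φ p) {A : Λ → 𝔄 | ∀ b' ∈ supp p, ‖A b'‖ < ε / W p})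
    (hcub : ∀ p ∈ Pl, ∀ (A : Λ → 𝔄) (σ : ℝ), 0 ≤ σ → σ < ε / W p → (∀ b' ∈ supp p, ‖A b'‖ ≤ σ) →
      ‖φ p A‖ ≤ κ / W p * σ ^ 3)
    (hloc : ∀ p ∈ Pl, ∀ A : Λ → 𝔄, ∀ b ∉ supp p, ∀ X : 𝔄, φ p (A + Pi.single b X) = φ p A)
    (hm : ∀ b : Λ, (Pl.filter (fun p => b ∈ supp p)).card ≤ m) :
    Prop4Hyp (fun Y : WMax w w' Dv =>
        ((WSup.toPiL w 3).symm (locGrad (fun A => ∑ p ∈ Pl, φ p A) (WSup.toPiL w 1 (toWSupL w w' Dv Y))) :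
          WSup w 3 (𝔄 →L[ℂ] ℂ)))
      (8 * κ * m * Lc ^ 4) (ε / 2) := by
  have hC : 0 ≤ 8 * κ * m * Lc ^ 4 := by
    have : 0 ≤ Lc := zero_le_one.trans hLc1
    positivity
  exact prop4Hyp_of_wsup w w' Dv
    (prop4Hyp_locGrad_levels Pl φ supp w W hε hκ hLc1 hW hWw hwW ha hcub hloc hm) hC

end Levels

end Summit.QuantumFields.BalabanUV.T4Continuum.ShellMeasureMultiGridNormsMax

end
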